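import Mathlib.Analysis.Distribution.AEEqOfIntegralContDiff
import Literature.Analysis.FluidPDE.DuchonRobertPressure
import Literature.Analysis.FunctionSpaces.DistributionalConstancy
import HarnessLib

/-!
# The slice-wise pressure Poisson equation of a distributional solution on the flat torus

Analysis/FluidPDE support file (theorem-only). For a distributional (pressure-explicit) solution
`(u, p)` of the unforced Navier–Stokes/Euler equations on `T^d × (0,T)`
(`Torus.IsDistributionalNSSolutionOn T ν 0 u p`, `FluidPDE/WeakSolution`: `u ∈ L²_{t,x}`,
`p ∈ L¹_{t,x}`, `u(t)` weakly divergence free for a.e. `t`, the momentum equation against all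
vector test fields supported in `(0,T)`), the pressure solves the **Poisson equation slice-wise**:
for every smooth `φ : T^d → ℝ`,

  `∫ p(t) Δφ dx = -∑ᵢⱼ ∫ uᵢuⱼ(t) ∂ᵢ∂ⱼφ dx`   for a.e. `t ∈ (0,T)`

(`IsDistributionalNSSolutionOn.ae_integral_pressure_mul_laplacian`; Robinson–Rodrigo–Sadowski 2016,
proof of Prop. 5.3, "`⟨-Δp, ψ(t)⟩ = ⟨∂ᵢ∂ⱼ(uᵢuⱼ), ψ(t)⟩` for almost every `t`"; Lemarié-Rieusset
2016, (13.19): "taking the divergence of the Navier–Stokes equations and using `div u = 0`,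
`Δp = -∑ᵢⱼ∂ᵢ∂ⱼ(uᵢuⱼ)`"). Proof: test the momentum equation with the gradient field
`Ψ(t,x) = η(t) ∇φ(x)`, `η ∈ C_c^∞((0,T))`; the terms `⟪u, ∂ₜΨ⟫ = η'⟪u, ∇φ⟫` and
`ν⟪u, ΔΨ⟫ = νη⟪u, ∇Δφ⟫` integrate to zero slice-wise by weak divergence-freeness, `div Ψ = η Δφ`
and `⟪u, (u·∇)∇φ⟫ = ∑ᵢⱼ uᵢuⱼ∂ᵢ∂ⱼφ` (`Torus.inner_convect_gradient`); so
`∫₀ᵀ η(t) F_φ(t) dt = 0` with `F_φ(t) = ∫ (⟪u,(u·∇)∇φ⟫ + pΔφ)(t)`, for all such `η`, and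
du Bois-Reymond's lemma (Mathlib's `IsOpen.ae_eq_zero_of_integral_contDiff_smul_eq_zero`) gives
`F_φ = 0` a.e. This is the converse of the tree's `Torus.integral_gradientPart_eq_zero`
(`DuchonRobertPressure`, the step from the weak Poisson equation to distributional solutions),
and it is the form in which the pressure of De Rosa–Isett's Thm. 2.7 (any `L^{3/2}` distributional
pressure) is compared with the Calderón–Zygmund pressure (op. cit. §3.4 and §5.1).

## Mathlib search

Mathlib (this pin): du Bois-Reymond `IsOpen.ae_eq_zero_of_integral_contDiff_smul_eq_zero`,
`Integrable.integral_prod_left`, `deriv_smul_const`; no Navier–Stokes notions. Tree: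
`DuchonRobertPressure` (`inner_convect_gradient`, `laplacian_gradient`,
`divergence_gradient_eq_laplacian`, slice integrability), `Onsager1949Proofs`-style test fields
(`FunctionSpaces.exists_Icc_subset_Ioo_of_tsupport_subset`).

## References

* J. C. Robinson, J. L. Rodrigo, W. Sadowski, *The Three-Dimensional Navier–Stokes Equations*
  (CUP 2016), §5.2, proof of Prop. 5.3 (pp. 89–90). [RobinsonRodrigoSadowskiCUP2016]
* P. G. Lemarié-Rieusset, *The Navier–Stokes Problem in the 21st Century* (CRC 2016), (13.19)
  p. 461. [LemarieRieusset2016]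
* L. De Rosa, P. Isett, Arch. Ration. Mech. Anal. 248 (2024), Paper No. 11, §3.4, §5.1.
  [DeRosaIsett2024]
-/

noncomputable section

open MeasureTheory Set Filter Topology Function UnitAddTorus
open scoped ENNReal NNReal InnerProductSpace RealInnerProductSpace ContDiff

namespace Literature.Analysis.FluidPDE.Torus

open Literature.Analysis.FunctionSpaces Literature.Analysis.FunctionSpaces.Torus

variable {d : Type*} [Fintype d] [DecidableEq d]

/-! ## The gradient test field `Ψ(t,x) = η(t) ∇φ(x)` -/

section TestField

variable {T : ℝ} {η : ℝ → ℝ} {φ : UnitAddTorus d → ℝ}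

omit [DecidableEq d] in
/-- For `η` smooth, compactly supported with `tsupport η ⊆ (0,T)` and `φ` smooth on `T^d`, the field
`Ψ(t,x) = η(t) ∇φ(x)` is a space–time test field supported in `(0,T)`. [folklore] -/
theorem isSpaceTimeTestIoo_smul_gradient (hT : 0 < T) (hη : ContDiff ℝ ∞ η)
    (hηc : HasCompactSupport η) (hηs : tsupport η ⊆ Ioo 0 T) (hφ : IsSmooth φ) :
    IsSpaceTimeTestIoo T (fun t x => η t • Torus.gradient φ x) := by
  obtain ⟨a, b, ha, -, hb, hz⟩ := FunctionSpaces.exists_Icc_subset_Ioo_of_tsupport_subset hT hηc hηs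
  have hz' : ∀ t, t ∉ Icc a b → η t = 0 := fun t ht => by
    by_contra h
    exact ht (hz t h)
  refine ⟨⟨?_, (b + T) / 2, by linarith, fun t ht => ?_⟩, a / 2, by linarith, fun t ht => ?_⟩
  · change ContDiff ℝ ∞ (fun q : ℝ × EuclideanSpace ℝ d => η q.1 • Torus.gradient φ (proj q.2))
    have h2 : ContDiff ℝ ∞ (fun q : ℝ × EuclideanSpace ℝ d => lift (Torus.gradient φ) q.2) :=
      hφ.gradient.comp contDiff_snd
    exact (hη.comp contDiff_fst).smul h2
  · funext x
    have h0 : η t = 0 := hz' t fun h => by linarith [h.2]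
    simp [h0]
  · funext x
    have h0 : η t = 0 := hz' t fun h => by linarith [h.1]
    simp [h0]

omit [DecidableEq d] in
/-- `∂ₜ(η ∇φ) = η' ∇φ`. [folklore] -/
theorem timeDeriv_smul_gradient (hη : Differentiable ℝ η) (t : ℝ) (x : UnitAddTorus d) :
    Torus.timeDeriv (fun s y => η s • Torus.gradient φ y) t x = deriv η t • Torus.gradient φ x := by
  simp only [Torus.timeDeriv]
  exact deriv_smul_const (hη t) _

omit [DecidableEq d] in
/-- `(u·∇)(η ∇φ) = η (u·∇)∇φ`. [folklore] -/
theorem convect_smul_gradient (hφ : IsSmooth φ) (u : UnitAddTorus d → EuclideanSpace ℝ d)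
    (c : ℝ) (x : UnitAddTorus d) :
    Torus.convect u (fun y => c • Torus.gradient φ y) x = c • Torus.convect u (Torus.gradient φ) x := by
  have hG : IsContDiff 1 (Torus.gradient φ) := hφ.gradient.isContDiff (by simp)
  have e : (fun y => c • Torus.gradient φ y) = c • Torus.gradient φ := rfl
  rw [Torus.convect, Torus.convect, e, fderiv_const_smul hG c]
  rfl

/-- `Δ(η ∇φ) = η ∇(Δφ)`. [folklore] -/
theorem laplacian_smul_gradient (hφ : IsSmooth φ) (c : ℝ) (x : UnitAddTorus d) :
    Torus.laplacian (fun y => c • Torus.gradient φ y) x = c • Torus.gradient (Torus.laplacian φ) x := by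
  have e : (fun y => c • Torus.gradient φ y) = c • Torus.gradient φ := rfl
  rw [e, laplacian_const_smul_apply hφ.gradient c x, laplacian_gradient hφ x]

/-- `div(η ∇φ) = η Δφ`. [folklore] -/
theorem divergence_smul_gradient (hφ : IsSmooth φ) (c : ℝ) (x : UnitAddTorus d) :
    Torus.divergence (fun y => c • Torus.gradient φ y) x = c * Torus.laplacian φ x := by
  rw [← divergence_gradient_eq_laplacian hφ x, Torus.divergence, Torus.divergence, Finset.mul_sum]
  refine Finset.sum_congr rfl fun i _ => ?_
  have hi : IsContDiff 1 (fun y => Torus.gradient φ y i) := (hφ.gradient.apply i).isContDiff (by simp)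
  have e : (fun y => (c • Torus.gradient φ y) i) = c • fun y => Torus.gradient φ y i := by
    funext y
    simp
  rw [e, partialDeriv_const_smul hi c i]
  rfl

end TestField

/-! ## The slice-wise Poisson equation -/

section Poisson

variable {T ν : ℝ} {u : ℝ → UnitAddTorus d → EuclideanSpace ℝ d} {p : ℝ → UnitAddTorus d → ℝ}

/-- **The pressure of a distributional solution solves the Poisson equation slice-wise**
(Robinson–Rodrigo–Sadowski 2016, proof of Prop. 5.3; Lemarié-Rieusset 2016, (13.19)): if `(u, p)` is
a distributional solution of the unforced Navier–Stokes equations with viscosity `ν` on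
`T^d × (0,T)`, then for every smooth `φ`,
`∫ p(t) Δφ = -∑ᵢⱼ ∫ uᵢuⱼ(t) ∂ᵢ∂ⱼφ` for a.e. `t ∈ (0,T)`. Proof: test with `η(t)∇φ`,
`η ∈ C_c^∞((0,T))`, kill `⟪u, ∂ₜΨ⟫` and `ν⟪u, ΔΨ⟫` slice-wise by weak divergence-freeness, and
apply du Bois-Reymond's lemma in `t` to `F_φ(t) = ∫ (⟪u,(u·∇)∇φ⟫ + pΔφ)(t)`. [cite: RobinsonRodrigoSadowskiCUP2016, Prop. 5.3 (pp. 89–90)] -/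
theorem _root_.Literature.Analysis.FluidPDE.Torus.IsDistributionalNSSolutionOn.ae_integral_pressure_mul_laplacian
    (hsol : IsDistributionalNSSolutionOn T ν 0 u p) (hT : 0 < T) {φ : UnitAddTorus d → ℝ}
    (hφ : IsSmooth φ) :
    ∀ᵐ t ∂(volume.restrict (Ioo 0 T)),
      ∫ x, p t x * Torus.laplacian φ x =
        -∑ i, ∑ j, ∫ x, u t x i * u t x j * Torus.partialDeriv i (Torus.partialDeriv j φ) x := by
  set μ : Measure ℝ := volume.restrict (Ioo 0 T) with hμ
  set μT := μ.prod (volume : Measure (UnitAddTorus d)) with hμT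
  have hum : AEStronglyMeasurable (uncurry u) μT := aestronglyMeasurable_uncurry_prod hsol.1
  have hpm : AEStronglyMeasurable (uncurry p) μT := aestronglyMeasurable_uncurry_prod hsol.2.2.1
  have hu2 : ∀ᵐ t ∂μ, MemLp (u t) 2 volume := ae_memLp_two_slice_of_isWeakNSSolutionOn hsol.isWeakNSSolutionOn
  have hp1 : ∀ᵐ t ∂μ, Integrable (p t) volume := ae_integrable_slice_of_lintegral hpm hsol.2.2.2.1
  have hdiv : ∀ᵐ t ∂μ, Torus.IsWeaklyDivFree (u t) := hsol.2.2.2.2.1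
  -- smoothness of the slices involved
  have hGs : IsSmooth (Torus.gradient φ) := hφ.gradient
  have hG1 : IsContDiff 1 (Torus.gradient φ) := hGs.isContDiff (by simp)
  have hLs : IsSmooth (Torus.laplacian φ) := hφ.laplacian
  have hGc : Continuous (Torus.gradient φ) := hGs.continuous
  have hLc : Continuous (Torus.laplacian φ) := hLs.continuous
  -- the two slice functionals
  set A : ℝ → ℝ := fun t => ∫ x, ⟪u t x, Torus.convect (u t) (Torus.gradient φ) x⟫ with hA
  set B : ℝ → ℝ := fun t => ∫ x, p t x * Torus.laplacian φ x with hB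
  -- integrability of the slice functionals on `(0,T)` (Fubini)
  obtain ⟨C, hC⟩ := exists_forall_norm_le_of_continuous hG1.continuous_fderiv
  obtain ⟨CL, hCL⟩ := exists_forall_norm_le_of_continuous hLc
  have hu2int : Integrable (fun z : ℝ × UnitAddTorus d => ‖u z.1 z.2‖ ^ 2) μT := by
    have hfin : ∫⁻ z, ‖u z.1 z.2‖ₑ ^ (2 : ℕ) ∂μT < ⊤ := by
      have h := hsol.2.1
      rw [lintegral_Ioo_lintegral_eq_lintegral_prod (hum.enorm.pow_const _)] at h
      exact h
    refine ⟨(hum.norm.pow 2), ?_⟩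
    refine lt_of_le_of_lt (lintegral_mono fun z => le_of_eq ?_) hfin
    rw [← ofReal_norm, norm_pow, norm_norm, ENNReal.ofReal_pow (norm_nonneg _), ofReal_norm]
  have hpint : Integrable (uncurry p) μT := by
    refine ⟨hpm, ?_⟩
    have h := hsol.2.2.2.1
    rw [lintegral_Ioo_lintegral_eq_lintegral_prod hpm.enorm] at h
    exact h
  have hAcore_m : AEStronglyMeasurable (fun z : ℝ × UnitAddTorus d =>
      ⟪u z.1 z.2, Torus.convect (u z.1) (Torus.gradient φ) z.2⟫) μT := by
    have h1 : AEStronglyMeasurable (fun z : ℝ × UnitAddTorus d => Torus.fderiv (Torus.gradient φ) z.2) μT :=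
      (hG1.continuous_fderiv.comp continuous_snd).aestronglyMeasurable
    have h2 : AEStronglyMeasurable (fun z : ℝ × UnitAddTorus d =>
        Torus.fderiv (Torus.gradient φ) z.2 (u z.1 z.2)) μT :=
      isBoundedBilinearMap_apply.continuous.comp_aestronglyMeasurable (h1.prodMk hum)
    exact hum.inner h2
  have hAint : Integrable (fun z : ℝ × UnitAddTorus d =>
      ⟪u z.1 z.2, Torus.convect (u z.1) (Torus.gradient φ) z.2⟫) μT := by
    refine Integrable.mono' (hu2int.mul_const C) hAcore_m (ae_of_all _ fun z => ?_)
    rw [Real.norm_eq_abs, Torus.convect]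
    calc |⟪u z.1 z.2, Torus.fderiv (Torus.gradient φ) z.2 (u z.1 z.2)⟫|
        ≤ ‖u z.1 z.2‖ * ‖Torus.fderiv (Torus.gradient φ) z.2 (u z.1 z.2)‖ := abs_real_inner_le_norm _ _
      _ ≤ ‖u z.1 z.2‖ * (‖Torus.fderiv (Torus.gradient φ) z.2‖ * ‖u z.1 z.2‖) :=
          mul_le_mul_of_nonneg_left (ContinuousLinearMap.le_opNorm _ _) (norm_nonneg _)
      _ ≤ ‖u z.1 z.2‖ * (C * ‖u z.1 z.2‖) := by gcongr; exact hC _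
      _ = ‖u z.1 z.2‖ ^ 2 * C := by ring
  have hBint : Integrable (fun z : ℝ × UnitAddTorus d => p z.1 z.2 * Torus.laplacian φ z.2) μT := by
    refine Integrable.mono' (hpint.norm.mul_const CL) (hpm.mul (hLc.comp continuous_snd).aestronglyMeasurable)
      (ae_of_all _ fun z => ?_)
    rw [norm_mul]
    exact mul_le_mul_of_nonneg_left (hCL _) (norm_nonneg _)
  have hAi : Integrable A μ := hAint.integral_prod_left
  have hBi : Integrable B μ := hBint.integral_prod_left
  -- the weak identity against `η ∇φ` reduces to `∫ η (A + B) = 0`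
  have key : ∀ η : ℝ → ℝ, ContDiff ℝ ∞ η → HasCompactSupport η → tsupport η ⊆ Ioo 0 T →
      ∫ t, η t * (A t + B t) ∂μ = 0 := by
    intro η hη hηc hηs
    have hΨ := isSpaceTimeTestIoo_smul_gradient hT hη hηc hηs hφ
    have hweak := hsol.2.2.2.2.2 _ hΨ
    have hηd : Differentiable ℝ η := hη.differentiable (by simp)
    -- slice-wise evaluation of the integrand
    have hslice : ∀ᵐ t ∂μ, ∫ x, (⟪u t x, Torus.timeDeriv (fun s y => η s • Torus.gradient φ y) t x⟫ +
        ⟪u t x, Torus.convect (u t) (fun y => η t • Torus.gradient φ y) x⟫ +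
        ν * ⟪u t x, Torus.laplacian (fun y => η t • Torus.gradient φ y) x⟫ +
        p t x * Torus.divergence (fun y => η t • Torus.gradient φ y) x +
        ⟪(0 : ℝ → UnitAddTorus d → EuclideanSpace ℝ d) t x, η t • Torus.gradient φ x⟫) =
          η t * (A t + B t) := by
      filter_upwards [hu2, hp1, hdiv] with t ht2 htp htdiv
      have e0 : ∀ x, ⟪u t x, Torus.timeDeriv (fun s y => η s • Torus.gradient φ y) t x⟫ +
          ⟪u t x, Torus.convect (u t) (fun y => η t • Torus.gradient φ y) x⟫ +
          ν * ⟪u t x, Torus.laplacian (fun y => η t • Torus.gradient φ y) x⟫ +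
          p t x * Torus.divergence (fun y => η t • Torus.gradient φ y) x +
          ⟪(0 : ℝ → UnitAddTorus d → EuclideanSpace ℝ d) t x, η t • Torus.gradient φ x⟫ =
            deriv η t * ⟪u t x, Torus.gradient φ x⟫ +
              η t * ⟪u t x, Torus.convect (u t) (Torus.gradient φ) x⟫ +
              (ν * η t) * ⟪u t x, Torus.gradient (Torus.laplacian φ) x⟫ +
              η t * (p t x * Torus.laplacian φ x) := by
        intro x
        rw [timeDeriv_smul_gradient hηd, convect_smul_gradient hφ, laplacian_smul_gradient hφ,
          divergence_smul_gradient hφ]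
        simp only [inner_smul_right, Pi.zero_apply, inner_zero_left]
        ring
      simp_rw [e0]
      have i1 : Integrable (fun x => deriv η t * ⟪u t x, Torus.gradient φ x⟫) volume :=
        (integrable_inner_continuous_of_memLp_two ht2 hGc).const_mul _
      have i2 : Integrable (fun x => η t * ⟪u t x, Torus.convect (u t) (Torus.gradient φ) x⟫) volume :=
        (integrable_inner_convect_of_memLp_two ht2 hG1).const_mul _
      have i3 : Integrable (fun x => (ν * η t) * ⟪u t x, Torus.gradient (Torus.laplacian φ) x⟫) volume :=
        (integrable_inner_continuous_of_memLp_two ht2 hLs.gradient.continuous).const_mul _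
      have i4' : Integrable (fun x => p t x * Torus.laplacian φ x) volume :=
        Integrable.mono' (htp.norm.mul_const CL) (htp.1.mul hLc.aestronglyMeasurable)
          (ae_of_all _ fun x => by
            rw [norm_mul]
            exact mul_le_mul_of_nonneg_left (hCL _) (norm_nonneg _))
      have i4 : Integrable (fun x => η t * (p t x * Torus.laplacian φ x)) volume := i4'.const_mul _
      have i12 : Integrable (fun x => deriv η t * ⟪u t x, Torus.gradient φ x⟫ +
          η t * ⟪u t x, Torus.convect (u t) (Torus.gradient φ) x⟫) volume := i1.add i2
      have i123 : Integrable (fun x => deriv η t * ⟪u t x, Torus.gradient φ x⟫ +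
          η t * ⟪u t x, Torus.convect (u t) (Torus.gradient φ) x⟫ +
          (ν * η t) * ⟪u t x, Torus.gradient (Torus.laplacian φ) x⟫) volume := i12.add i3
      rw [integral_add i123 i4, integral_add i12 i3, integral_add i1 i2, integral_const_mul,
        integral_const_mul, integral_const_mul, integral_const_mul, htdiv φ hφ,
        htdiv (Torus.laplacian φ) hLs]
      simp only [hA, hB]
      ring
    rw [integral_congr_ae hslice] at hweak
    exact hweak
  -- du Bois-Reymond
  set F : ℝ → ℝ := fun t => A t + B t with hF
  have hFi : IntegrableOn F (Ioo 0 T) volume := hAi.add hBi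
  have hzero : ∀ᵐ t ∂(volume : Measure ℝ), t ∈ Ioo 0 T → F t = 0 := by
    refine isOpen_Ioo.ae_eq_zero_of_integral_contDiff_smul_eq_zero hFi.locallyIntegrableOn
      fun g hg hgc hgs => ?_
    have h1 : ∫ t, g t • F t = ∫ t in Ioo 0 T, g t • F t := by
      refine (setIntegral_eq_integral_of_forall_compl_eq_zero fun t ht => ?_).symm
      have : g t = 0 := image_eq_zero_of_notMem_tsupport fun h => ht (hgs h)
      simp [this]
    rw [h1]
    simpa [smul_eq_mul] using key g hg hgc hgs
  have hzero' : ∀ᵐ t ∂μ, F t = 0 := (ae_restrict_iff' measurableSet_Ioo).2 hzero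
  -- conclusion
  filter_upwards [hzero', hu2] with t ht ht2
  have hAB : B t = -A t := by
    have h : A t + B t = 0 := ht
    linarith
  have hAsum : A t = ∑ i, ∑ j, ∫ x, u t x i * u t x j * Torus.partialDeriv i (Torus.partialDeriv j φ) x := by
    simp only [hA]
    have e1 : ∀ x, ⟪u t x, Torus.convect (u t) (Torus.gradient φ) x⟫ =
        ∑ i, ∑ j, u t x i * u t x j * Torus.partialDeriv i (Torus.partialDeriv j φ) x := by
      intro x
      rw [inner_convect_gradient hφ, Finset.sum_comm]
      refine Finset.sum_congr rfl fun i _ => Finset.sum_congr rfl fun j _ => ?_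
      ring
    simp_rw [e1]
    have hint : ∀ i j, Integrable (fun x => u t x i * u t x j *
        Torus.partialDeriv i (Torus.partialDeriv j φ) x) volume := fun i j =>
      integrable_coord_mul_coord_mul ht2 i j ((hφ.partialDeriv j).partialDeriv i).continuous
    rw [integral_finsetSum _ fun i _ => integrable_finsetSum _ fun j _ => hint i j]
    refine Finset.sum_congr rfl fun i _ => ?_
    rw [integral_finsetSum _ fun j _ => hint i j]
  show B t = _
  rw [hAB, hAsum]

end Poisson

end Literature.Analysis.FluidPDE.Torus

end
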